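import Summits.QuantumFields.BalabanUV.Beta.GAN24.WilsonFaceGradedIdentity

/-!
# `BalabanUV.Beta.GAN24.WilsonLegCurrent` — binder row G-an2-4 ∕ (CONV-C), W-slot CT-W, conservation law (C)∕(C)sym: **THE TWO-LEG BIWEIGHTED CONTRACTION OF an3's
# CUBIC WILSON STENCIL IS THE SAME CURRENT, READ ON THE SLOT** — for `α ≠ β` and ARBITRARY weights `P Q : ℤ → ℝ` of the first leg's `α`-coordinate and the second
# leg's `β`-coordinate, the `(inl α, inl β)`-block summed over both legs at the slot `(κ, u)` is `[κ = α]·P(u_α)·(Q(u_β − 1) − Q(u_β)) + [κ = β]·Q(u_β)·(P(u_α) − P(u_α − 1))`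
# (companion of `GAN24/WilsonEdgeCurrent`: contracting ANY two of the three bonds of the cubic table with separable coordinate weights gives minus one half of
# `AffineAveraging.curvAdj` of the product 2-form on the third; generic `d`)

NOT IN PRINT; OUR BOOKKEEPING ([folklore] finite stencil algebra over an3's DEFINED tables `PlaquetteStencilData.wα ∕ wβ ∕ wm` read through leaf-15's register
`WilsonVertexSumZero` (`uv`, `wc`), this lineage's `WilsonGradedBlockSums` §1 and `WilsonFaceGradedIdentity.sum_weighted_wilsonA` BY NAME; G-an2-4 formalisation swarm, leaf
prover `b2b-balaban-gan24-formalise-leaf-04`, gen 64).  HONEST FRAMING (cell contract, verbatim): «discharging `BetaPertH` makes Bałaban's UV stability UNCONDITIONAL — a real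
constructive-QFT result; it is NOT the continuum limit and NOT the Clay problem.»  HONEST DEPENDENCY (verbatim): «continuum YM on T⁴ ⇐ BetaPertH ∧ nine spine estimates (0/9
proved); BetaPertH ⇐ (D1) ∧ (D4) ∧ CAP+tail; G-an2-4 gates asym, D1 and NE2/3/4.»

WHY (located use; this lineage's note `HOME/b2b-balaban-gan24-formalise-leaf-04/g64/CSYM-D3-ANATOMY.md` §3 (a)∕§8): in the second-response word (RESP) of the dressed second-order
step on constant coarse test forms, the first cubic vertex carries the two face forms `Lc·𝟙_face` on its LEGS and the propagated second response on its SLOT; with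
`P = Q = 𝟙[· ≡ −1 (mod Lc)]` the present identity says that leg-side factor is the edge current `−d*𝟙_{E(α,β)}` on the slot bond — the same object as the slot-side half-vertex
of `WilsonEdgeCurrent` (the located reason the RESP word pairs two currents).  It also contains the separable case of this lineage's (W-face) gradings.

MECHANISM (generic `d`; no `decide`): `sum_weighted_wilsonA` at the slot `(κ, u)` with `F x z := P(x_α)·Q(z_β)` gives `½((G1) − (G2))`, (G1) `Σ_i P((wα i)_α)·Q((wβ i)_β)·wc κ i α β`,
(G2) `Σ_i P((wβ i)_α)·Q((wα i)_β)·wc κ i β α`; family by family: the SPIN family gives `[κ = β]·2·Q 0·(P 0 − P(−1)) + [κ = α]·2·P 0·(Q(−1) − Q 0)` to (G1) and its negative to (G2)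
(`sTot = −2`), the LONGITUDINAL family gives `[κ = α]·2·P 0·(Q 0 − Q(−1))` to (G1) and `[κ = β]·2·Q 0·(P 0 − P(−1))` to (G2), the CURRENT family (`α ≠ β`) and the three REMAINDER
families give `0` to both; exact per-family tables agree at `d+1 = 2, 3, 4` (`g64/num/bileg_fam.py`, DIAG).

WHAT ([folklore]; 0 `def`, 0 cited facts, 0 `def … : Prop`, 0 sorry): §1 per-family lemmas and totals `g1_total`, `g2_total`; §2 **`sum_box_bileg_wilsonA`** (slot `(κ, 0)`) and
**`sum_box_bileg_wilsonA_at`** (slot `(κ, u)`).  Asserts NO value of Bałaban's tables beyond these finite identities of an3's defined stencil; discharges NOTHING of (C)sym ∕ (Q-D) ∕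
(Q-D-rate) ∕ «T2Shape» ∕ «T2Drift» ∕ (hW, hWall) ∕ D1; NEVER «G-an2-4 closed» as (CONV-C); NOT D1, NOT `BetaPertH`, NOT continuum, NOT Clay.  2026-08-22; no existing file touched.
-/

noncomputable section

open Finset
open scoped BigOperators
open Literature.MathematicalPhysics.QuantumFieldTheory.Balaban1983to89
open Literature.MathematicalPhysics.QuantumFieldTheory.Balaban1983to89.Beta
open B6BondElimination (unitVec unitVec_apply)
open PlaquetteStencilData (WilsonIdx RemIdx wα wβ wm fam trm dim bsm rmm dvm dvβ rmα rmβ bsα bsβ boff bd₁ bd₂ bsgn diα diβ trα trβ faα faβ)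
open PlaquetteStencil (dirBlock dirBlock_apply)
open GhostTable (curM copies curα curβ)
open SpinTable (spM spα spinMat spinMat_apply spinDir spinDir_apply)
open PlaquetteWeitzenbock (sTot)
open StepJetData (wilsonA wilsonA_translate)
open BalabanStepJets (box1)
open ExpKernelCalculus (shiftK)
open Summit.QuantumFields.BalabanUV.Beta.GAN24.WilsonVertexSumZero (uv wc suppW_subset_box)
open Summit.QuantumFields.BalabanUV.Beta.GAN24.WilsonGradedBlockSums (dirBlock_one_apply copies_one_apply spinMat_one_apply wα_cur wβ_cur wc_cur
  wα_spin wβ_spin wc_spin wα_div wβ_div wc_div wα_di wβ_di wc_di wα_tr wβ_tr wc_tr wα_fa wβ_fa wc_fa)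
open Summit.QuantumFields.BalabanUV.Beta.GAN24.WilsonFaceGradedIdentity (sum_weighted_wilsonA suppW_zero_subset_box1)

namespace Summit.QuantumFields.BalabanUV.Beta.GAN24.WilsonLegCurrent

variable {d : ℕ}

/-! ## §1 The two leg-weighted stencil sums, family by family -/

section Fam

variable (κ : Fin (d + 1)) {α β : Fin (d + 1)} (hαβ : α ≠ β) (P Q : ℤ → ℝ)
include hαβ

/-! ### (G1): `Σ_i P((wα i)_α)·Q((wβ i)_β)·wc κ i α β` -/

/-- [folklore] (G1), current family: `0` (`α ≠ β` kills every entry of `± copies`). -/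
theorem g1_cur : ∑ c : Bool, P ((wα uv κ (Sum.inl (Sum.inl (Sum.inl c)) : WilsonIdx (Fin (d + 1)))) α) *
    Q ((wβ uv κ (Sum.inl (Sum.inl (Sum.inl c)) : WilsonIdx (Fin (d + 1)))) β) * wc κ (Sum.inl (Sum.inl (Sum.inl c))) α β = 0 := by
  simp [wc_cur, hαβ]

/-- [folklore] (G1), spin family: `[κ = β]·2·Q 0·(P 0 − P(−1)) + [κ = α]·2·P 0·(Q(−1) − Q 0)`. -/
theorem g1_spin : ∑ pr : Fin (d + 1) × Bool, P ((wα uv κ (Sum.inl (Sum.inl (Sum.inr pr)) : WilsonIdx (Fin (d + 1)))) α) *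
    Q ((wβ uv κ (Sum.inl (Sum.inl (Sum.inr pr)) : WilsonIdx (Fin (d + 1)))) β) * wc κ (Sum.inl (Sum.inl (Sum.inr pr))) α β =
    (if κ = β then 2 * (Q 0 * (P 0 - P (-1))) else 0) + (if κ = α then 2 * (P 0 * (Q (-1) - Q 0)) else 0) := by
  rw [Fintype.sum_prod_type]
  have hterm : ∀ ν : Fin (d + 1), ∑ c : Bool, P ((wα uv κ (Sum.inl (Sum.inl (Sum.inr (ν, c))) : WilsonIdx (Fin (d + 1)))) α) *
      Q ((wβ uv κ (Sum.inl (Sum.inl (Sum.inr (ν, c))) : WilsonIdx (Fin (d + 1)))) β) * wc κ (Sum.inl (Sum.inl (Sum.inr (ν, c)))) α β =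
      (if ν = α ∧ κ = β then 2 * (Q 0 * (P 0 - P (-1))) else 0) + (if ν = β ∧ κ = α then 2 * (P 0 * (Q (-1) - Q 0)) else 0) := by
    intro ν
    rw [Fintype.sum_bool]
    simp only [wα_spin, wβ_spin, wc_spin, if_true, Bool.false_eq_true, if_false, Pi.neg_apply, Pi.zero_apply, uv, unitVec_apply, sTot]
    by_cases hνα : ν = α
    · subst hνα
      by_cases hκβ : κ = β
      · subst hκβ; simp [hαβ, hαβ.symm]; ring
      · simp [hαβ, hαβ.symm, hκβ]
    · by_cases hνβ : ν = β
      · subst hνβ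
        by_cases hκα : κ = α
        · subst hκα; simp [hαβ, hαβ.symm]; ring
        · simp [hαβ, hαβ.symm, hκα]
      · simp [hνα, hνβ, Ne.symm hνα, Ne.symm hνβ]
  simp_rw [hterm]
  rw [Finset.sum_add_distrib]
  congr 1
  · rw [Finset.sum_ite, Finset.sum_const_zero, add_zero]
    by_cases hκβ : κ = β
    · simp [hκβ, Finset.filter_eq']
    · simp [hκβ]
  · rw [Finset.sum_ite, Finset.sum_const_zero, add_zero]
    by_cases hκα : κ = α
    · simp [hκα, Finset.filter_eq']
    · simp [hκα]

/-- [folklore] (G1), longitudinal family: `[κ = α]·2·P 0·(Q 0 − Q(−1))`. -/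
theorem g1_div : ∑ pr : Fin (d + 1) × Bool, P ((wα uv κ (Sum.inl (Sum.inr pr) : WilsonIdx (Fin (d + 1)))) α) *
    Q ((wβ uv κ (Sum.inl (Sum.inr pr) : WilsonIdx (Fin (d + 1)))) β) * wc κ (Sum.inl (Sum.inr pr)) α β =
    if κ = α then 2 * (P 0 * (Q 0 - Q (-1))) else 0 := by
  rw [Fintype.sum_prod_type, Finset.sum_eq_single_of_mem β (Finset.mem_univ β)]
  · rw [Fintype.sum_bool]
    simp only [wα_div, wβ_div, wc_div, if_true, Bool.false_eq_true, if_false, Pi.zero_apply, Pi.sub_apply, uv, unitVec_apply, and_true]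
    by_cases hκα : κ = α
    · subst hκα; simp [Ne.symm hαβ]; ring
    · simp [hκα, Ne.symm hκα]
  · intro ν _ hν
    rw [Fintype.sum_bool]
    simp only [wc_div]
    simp [Ne.symm hν]

/-- [folklore] (G1), difference family: `0`. -/
theorem g1_di : ∑ pr : Fin (d + 1) × (Fin 4 × Fin 12), P ((wα uv κ (Sum.inr (Sum.inl (Sum.inl pr)) : WilsonIdx (Fin (d + 1)))) α) *
    Q ((wβ uv κ (Sum.inr (Sum.inl (Sum.inl pr)) : WilsonIdx (Fin (d + 1)))) β) * wc κ (Sum.inr (Sum.inl (Sum.inl pr))) α β = 0 := by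
  rw [Fintype.sum_prod_type]
  refine Finset.sum_eq_zero fun ν _ => ?_
  rw [Fintype.sum_prod_type]
  simp only [Fin.sum_univ_succ, Fin.sum_univ_zero, wα_di, wβ_di, wc_di, bd₁, bd₂, bsgn, boff, diα, diβ, dim, Matrix.cons_val_zero,
    Matrix.cons_val_succ, Matrix.smul_apply, Matrix.neg_apply, Pi.add_apply, Pi.neg_apply, Pi.zero_apply, dirBlock_one_apply,
    uv, unitVec_apply, smul_eq_mul]
  by_cases hν : ν = α
  · subst hν
    by_cases hκ : κ = β
    · subst hκ; simp [hαβ, hαβ.symm]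
    · simp [hαβ.symm, Ne.symm hκ]
  · by_cases hν' : ν = β
    · subst hν'
      by_cases hκ : κ = α
      · subst hκ; simp [hαβ, hαβ.symm]
      · simp [hαβ, Ne.symm hκ]
    · simp [Ne.symm hν, Ne.symm hν']

/-- [folklore] (G1), transport family: `0`. -/
theorem g1_tr : ∑ pr : Fin (d + 1) × (Fin 4 × Fin 8), P ((wα uv κ (Sum.inr (Sum.inl (Sum.inr pr)) : WilsonIdx (Fin (d + 1)))) α) *
    Q ((wβ uv κ (Sum.inr (Sum.inl (Sum.inr pr)) : WilsonIdx (Fin (d + 1)))) β) * wc κ (Sum.inr (Sum.inl (Sum.inr pr))) α β = 0 := by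
  rw [Fintype.sum_prod_type]
  refine Finset.sum_eq_zero fun ν _ => ?_
  rw [Fintype.sum_prod_type]
  simp only [Fin.sum_univ_succ, Fin.sum_univ_zero, wα_tr, wβ_tr, wc_tr, bd₁, bd₂, bsgn, boff, trα, trβ, trm, Matrix.cons_val_zero,
    Matrix.cons_val_succ, Matrix.neg_apply, Pi.add_apply, Pi.neg_apply, Pi.zero_apply, dirBlock_one_apply, uv, unitVec_apply]
  by_cases hν : ν = α
  · subst hν
    by_cases hκ : κ = β
    · subst hκ; simp [hαβ, hαβ.symm]
    · simp [hαβ.symm, Ne.symm hκ]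
  · by_cases hν' : ν = β
    · subst hν'
      by_cases hκ : κ = α
      · subst hκ; simp [hαβ, hαβ.symm]
      · simp [hαβ, Ne.symm hκ]
    · simp [Ne.symm hν, Ne.symm hν']

/-- [folklore] (G1), far-corner family: `0`. -/
theorem g1_fa : ∑ pr : Fin (d + 1) × (Fin 4 × Bool), P ((wα uv κ (Sum.inr (Sum.inr pr) : WilsonIdx (Fin (d + 1)))) α) *
    Q ((wβ uv κ (Sum.inr (Sum.inr pr) : WilsonIdx (Fin (d + 1)))) β) * wc κ (Sum.inr (Sum.inr pr)) α β = 0 := by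
  rw [Fintype.sum_prod_type]
  refine Finset.sum_eq_zero fun ν _ => ?_
  rw [Fintype.sum_prod_type]
  simp only [Fin.sum_univ_succ, Fin.sum_univ_zero, Fintype.sum_bool, wα_fa, wβ_fa, wc_fa, bd₁, bd₂, bsgn, boff, faα, faβ, fam,
    Matrix.cons_val_zero, Matrix.cons_val_succ, Matrix.neg_apply, Pi.add_apply, Pi.neg_apply, Pi.zero_apply, dirBlock_one_apply, uv,
    unitVec_apply, if_true, Bool.false_eq_true, if_false]
  by_cases hν : ν = α
  · subst hν
    by_cases hκ : κ = β
    · subst hκ; simp [hαβ, hαβ.symm]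
    · simp [hαβ.symm, Ne.symm hκ]
  · by_cases hν' : ν = β
    · subst hν'
      by_cases hκ : κ = α
      · subst hκ; simp [hαβ, hαβ.symm]
      · simp [hαβ, Ne.symm hκ]
    · simp [Ne.symm hν, Ne.symm hν']

/-- [folklore] **(G1) TOTAL**. -/
theorem g1_total : ∑ i : WilsonIdx (Fin (d + 1)), P ((wα uv κ i) α) * Q ((wβ uv κ i) β) * wc κ i α β =
    (if κ = β then 2 * (Q 0 * (P 0 - P (-1))) else 0) + (if κ = α then 2 * (P 0 * (Q (-1) - Q 0)) else 0)
      + (if κ = α then 2 * (P 0 * (Q 0 - Q (-1))) else 0) := by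
  rw [Fintype.sum_sum_type, Fintype.sum_sum_type, Fintype.sum_sum_type, Fintype.sum_sum_type, Fintype.sum_sum_type,
    g1_cur κ hαβ P Q, g1_spin κ hαβ P Q, g1_div κ hαβ P Q, g1_di κ hαβ P Q, g1_tr κ hαβ P Q, g1_fa κ hαβ P Q]
  ring

/-! ### (G2): `Σ_i P((wβ i)_α)·Q((wα i)_β)·wc κ i β α` -/

/-- [folklore] (G2), current family: `0`. -/
theorem g2_cur : ∑ c : Bool, P ((wβ uv κ (Sum.inl (Sum.inl (Sum.inl c)) : WilsonIdx (Fin (d + 1)))) α) *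
    Q ((wα uv κ (Sum.inl (Sum.inl (Sum.inl c)) : WilsonIdx (Fin (d + 1)))) β) * wc κ (Sum.inl (Sum.inl (Sum.inl c))) β α = 0 := by
  simp [wc_cur, hαβ.symm]

/-- [folklore] (G2), spin family: the negative of (G1)'s. -/
theorem g2_spin : ∑ pr : Fin (d + 1) × Bool, P ((wβ uv κ (Sum.inl (Sum.inl (Sum.inr pr)) : WilsonIdx (Fin (d + 1)))) α) *
    Q ((wα uv κ (Sum.inl (Sum.inl (Sum.inr pr)) : WilsonIdx (Fin (d + 1)))) β) * wc κ (Sum.inl (Sum.inl (Sum.inr pr))) β α =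
    (if κ = β then 2 * (Q 0 * (P (-1) - P 0)) else 0) + (if κ = α then 2 * (P 0 * (Q 0 - Q (-1))) else 0) := by
  rw [Fintype.sum_prod_type]
  have hterm : ∀ ν : Fin (d + 1), ∑ c : Bool, P ((wβ uv κ (Sum.inl (Sum.inl (Sum.inr (ν, c))) : WilsonIdx (Fin (d + 1)))) α) *
      Q ((wα uv κ (Sum.inl (Sum.inl (Sum.inr (ν, c))) : WilsonIdx (Fin (d + 1)))) β) * wc κ (Sum.inl (Sum.inl (Sum.inr (ν, c)))) β α =
      (if ν = α ∧ κ = β then 2 * (Q 0 * (P (-1) - P 0)) else 0) + (if ν = β ∧ κ = α then 2 * (P 0 * (Q 0 - Q (-1))) else 0) := by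
    intro ν
    rw [Fintype.sum_bool]
    simp only [wα_spin, wβ_spin, wc_spin, if_true, Bool.false_eq_true, if_false, Pi.neg_apply, Pi.zero_apply, uv, unitVec_apply, sTot]
    by_cases hνα : ν = α
    · subst hνα
      by_cases hκβ : κ = β
      · subst hκβ; simp [hαβ, hαβ.symm]; ring
      · simp [hαβ, hαβ.symm, hκβ]
    · by_cases hνβ : ν = β
      · subst hνβ
        by_cases hκα : κ = α
        · subst hκα; simp [hαβ, hαβ.symm]; ring
        · simp [hαβ, hαβ.symm, hκα]
      · simp [hνα, hνβ, Ne.symm hνα, Ne.symm hνβ]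
  simp_rw [hterm]
  rw [Finset.sum_add_distrib]
  congr 1
  · rw [Finset.sum_ite, Finset.sum_const_zero, add_zero]
    by_cases hκβ : κ = β
    · simp [hκβ, Finset.filter_eq']
    · simp [hκβ]
  · rw [Finset.sum_ite, Finset.sum_const_zero, add_zero]
    by_cases hκα : κ = α
    · simp [hκα, Finset.filter_eq']
    · simp [hκα]

/-- [folklore] (G2), longitudinal family: `[κ = β]·2·Q 0·(P 0 − P(−1))`. -/
theorem g2_div : ∑ pr : Fin (d + 1) × Bool, P ((wβ uv κ (Sum.inl (Sum.inr pr) : WilsonIdx (Fin (d + 1)))) α) *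
    Q ((wα uv κ (Sum.inl (Sum.inr pr) : WilsonIdx (Fin (d + 1)))) β) * wc κ (Sum.inl (Sum.inr pr)) β α =
    if κ = β then 2 * (Q 0 * (P 0 - P (-1))) else 0 := by
  rw [Fintype.sum_prod_type, Finset.sum_eq_single_of_mem α (Finset.mem_univ α)]
  · rw [Fintype.sum_bool]
    simp only [wα_div, wβ_div, wc_div, if_true, Bool.false_eq_true, if_false, Pi.zero_apply, Pi.sub_apply, uv, unitVec_apply, and_true]
    by_cases hκβ : κ = β
    · subst hκβ; simp [hαβ]; ring
    · simp [hκβ, Ne.symm hκβ]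
  · intro ν _ hν
    rw [Fintype.sum_bool]
    simp only [wc_div]
    simp [Ne.symm hν]

/-- [folklore] (G2), difference family: `0`. -/
theorem g2_di : ∑ pr : Fin (d + 1) × (Fin 4 × Fin 12), P ((wβ uv κ (Sum.inr (Sum.inl (Sum.inl pr)) : WilsonIdx (Fin (d + 1)))) α) *
    Q ((wα uv κ (Sum.inr (Sum.inl (Sum.inl pr)) : WilsonIdx (Fin (d + 1)))) β) * wc κ (Sum.inr (Sum.inl (Sum.inl pr))) β α = 0 := by
  rw [Fintype.sum_prod_type]
  refine Finset.sum_eq_zero fun ν _ => ?_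
  rw [Fintype.sum_prod_type]
  simp only [Fin.sum_univ_succ, Fin.sum_univ_zero, wα_di, wβ_di, wc_di, bd₁, bd₂, bsgn, boff, diα, diβ, dim, Matrix.cons_val_zero,
    Matrix.cons_val_succ, Matrix.smul_apply, Matrix.neg_apply, Pi.add_apply, Pi.neg_apply, Pi.zero_apply, dirBlock_one_apply,
    uv, unitVec_apply, smul_eq_mul]
  by_cases hν : ν = α
  · subst hν
    by_cases hκ : κ = β
    · subst hκ; simp [hαβ, hαβ.symm]
    · simp [hαβ.symm, Ne.symm hκ]
  · by_cases hν' : ν = β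
    · subst hν'
      by_cases hκ : κ = α
      · subst hκ; simp [hαβ, hαβ.symm]
      · simp [hαβ, Ne.symm hκ]
    · simp [Ne.symm hν, Ne.symm hν']

/-- [folklore] (G2), transport family: `0`. -/
theorem g2_tr : ∑ pr : Fin (d + 1) × (Fin 4 × Fin 8), P ((wβ uv κ (Sum.inr (Sum.inl (Sum.inr pr)) : WilsonIdx (Fin (d + 1)))) α) *
    Q ((wα uv κ (Sum.inr (Sum.inl (Sum.inr pr)) : WilsonIdx (Fin (d + 1)))) β) * wc κ (Sum.inr (Sum.inl (Sum.inr pr))) β α = 0 := by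
  rw [Fintype.sum_prod_type]
  refine Finset.sum_eq_zero fun ν _ => ?_
  rw [Fintype.sum_prod_type]
  simp only [Fin.sum_univ_succ, Fin.sum_univ_zero, wα_tr, wβ_tr, wc_tr, bd₁, bd₂, bsgn, boff, trα, trβ, trm, Matrix.cons_val_zero,
    Matrix.cons_val_succ, Matrix.neg_apply, Pi.add_apply, Pi.neg_apply, Pi.zero_apply, dirBlock_one_apply, uv, unitVec_apply]
  by_cases hν : ν = α
  · subst hν
    by_cases hκ : κ = β
    · subst hκ; simp [hαβ, hαβ.symm]
    · simp [hαβ.symm, Ne.symm hκ]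
  · by_cases hν' : ν = β
    · subst hν'
      by_cases hκ : κ = α
      · subst hκ; simp [hαβ, hαβ.symm]
      · simp [hαβ, Ne.symm hκ]
    · simp [Ne.symm hν, Ne.symm hν']

/-- [folklore] (G2), far-corner family: `0`. -/
theorem g2_fa : ∑ pr : Fin (d + 1) × (Fin 4 × Bool), P ((wβ uv κ (Sum.inr (Sum.inr pr) : WilsonIdx (Fin (d + 1)))) α) *
    Q ((wα uv κ (Sum.inr (Sum.inr pr) : WilsonIdx (Fin (d + 1)))) β) * wc κ (Sum.inr (Sum.inr pr)) β α = 0 := by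
  rw [Fintype.sum_prod_type]
  refine Finset.sum_eq_zero fun ν _ => ?_
  rw [Fintype.sum_prod_type]
  simp only [Fin.sum_univ_succ, Fin.sum_univ_zero, Fintype.sum_bool, wα_fa, wβ_fa, wc_fa, bd₁, bd₂, bsgn, boff, faα, faβ, fam,
    Matrix.cons_val_zero, Matrix.cons_val_succ, Matrix.neg_apply, Pi.add_apply, Pi.neg_apply, Pi.zero_apply, dirBlock_one_apply, uv,
    unitVec_apply, if_true, Bool.false_eq_true, if_false]
  by_cases hν : ν = α
  · subst hν
    by_cases hκ : κ = β
    · subst hκ; simp [hαβ, hαβ.symm]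
    · simp [hαβ.symm, Ne.symm hκ]
  · by_cases hν' : ν = β
    · subst hν'
      by_cases hκ : κ = α
      · subst hκ; simp [hαβ, hαβ.symm]
      · simp [hαβ, Ne.symm hκ]
    · simp [Ne.symm hν, Ne.symm hν']

/-- [folklore] **(G2) TOTAL**. -/
theorem g2_total : ∑ i : WilsonIdx (Fin (d + 1)), P ((wβ uv κ i) α) * Q ((wα uv κ i) β) * wc κ i β α =
    (if κ = β then 2 * (Q 0 * (P (-1) - P 0)) else 0) + (if κ = α then 2 * (P 0 * (Q 0 - Q (-1))) else 0)
      + (if κ = β then 2 * (Q 0 * (P 0 - P (-1))) else 0) := by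
  rw [Fintype.sum_sum_type, Fintype.sum_sum_type, Fintype.sum_sum_type, Fintype.sum_sum_type, Fintype.sum_sum_type,
    g2_cur κ hαβ P Q, g2_spin κ hαβ P Q, g2_div κ hαβ P Q, g2_di κ hαβ P Q, g2_tr κ hαβ P Q, g2_fa κ hαβ P Q]
  ring

end Fam

/-! ## §2 The two-leg biweighted sum of the antisymmetrised table is the current on the slot -/

section Current

variable {α β : Fin (d + 1)} (hαβ : α ≠ β)
include hαβ

/-- [folklore] **THE TWO-LEG BIWEIGHTED CONTRACTION OF THE CUBIC WILSON TABLE IS A CURRENT ON THE SLOT** (slot `(κ, 0)`; generic `d`; `α ≠ β`; every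
`P Q : ℤ → ℝ`): `Σ_{x,z ∈ box1} P(x_α)·Q(z_β)·wilsonA d κ 0 x z (inl α) (inl β) = [κ = α]·P 0·(Q(−1) − Q 0) + [κ = β]·Q 0·(P 0 − P(−1))`. -/
theorem sum_box_bileg_wilsonA (κ : Fin (d + 1)) (P Q : ℤ → ℝ) :
    ∑ x ∈ box1 (d + 1), ∑ z ∈ box1 (d + 1), P (x α) * Q (z β) * wilsonA d κ 0 x z (Sum.inl α) (Sum.inl β) =
      (if κ = α then P 0 * (Q (-1) - Q 0) else 0) + (if κ = β then Q 0 * (P 0 - P (-1)) else 0) := by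
  have h := sum_weighted_wilsonA κ 0 α β (box1 (d + 1)) (suppW_zero_subset_box1 κ) (fun x z => P (x α) * Q (z β))
  simp only [zero_add] at h
  rw [h, g1_total κ hαβ P Q, g2_total κ hαβ P Q]
  have hκκ : ¬(κ = α ∧ κ = β) := fun hh => hαβ (hh.1.symm.trans hh.2)
  by_cases hκα : κ = α
  · have hκβ : κ ≠ β := fun h' => hκκ ⟨hκα, h'⟩
    simp only [hκα, if_true, if_neg (hκα ▸ hκβ : α ≠ β)]
    ring
  · by_cases hκβ : κ = β
    · simp only [hκβ, if_true, if_neg (hκβ ▸ hκα : ¬ β = α)]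
      ring
    · simp only [hκα, hκβ, if_false]
      ring

/-- [folklore] **THE SAME AT A GENERAL SLOT `(κ, u)`** (legs over the translated boxes `u + box1`): `Σ_{x,z ∈ box1} P((u+x)_α)·Q((u+z)_β)·wilsonA d κ u (u+x) (u+z)
(inl α) (inl β) = [κ = α]·P(u_α)·(Q(u_β − 1) − Q(u_β)) + [κ = β]·Q(u_β)·(P(u_α) − P(u_α − 1))` — with `P = Q = 𝟙[· ≡ −1 (mod Lc)]` minus the boundary circulation of
the indicator of the `(α, β)`-plaquettes along the block edge, read on the SLOT bond `(κ, u)`. -/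
theorem sum_box_bileg_wilsonA_at (κ : Fin (d + 1)) (P Q : ℤ → ℝ) (u : Fin (d + 1) → ℤ) :
    ∑ x ∈ box1 (d + 1), ∑ z ∈ box1 (d + 1), P ((u + x) α) * Q ((u + z) β) * wilsonA d κ u (u + x) (u + z) (Sum.inl α) (Sum.inl β) =
      (if κ = α then P (u α) * (Q (u β - 1) - Q (u β)) else 0) + (if κ = β then Q (u β) * (P (u α) - P (u α - 1)) else 0) := by
  have key := sum_box_bileg_wilsonA hαβ κ (fun t => P (u α + t)) (fun t => Q (u β + t))
  have e : ∀ x z : Fin (d + 1) → ℤ,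
      wilsonA d κ u (u + x) (u + z) (Sum.inl α) (Sum.inl β) = wilsonA d κ 0 x z (Sum.inl α) (Sum.inl β) := by
    intro x z
    have h := wilsonA_translate (d := d) κ 0 u
    rw [zero_add] at h
    rw [h]
    show wilsonA d κ 0 (u + x + -u) (u + z + -u) (Sum.inl α) (Sum.inl β) = _
    congr 1
    · abel
    · abel
  have ep : ∀ x z : Fin (d + 1) → ℤ, P ((u + x) α) * Q ((u + z) β) = P (u α + x α) * Q (u β + z β) := by
    intro x z
    simp only [Pi.add_apply]
  simp_rw [e, ep]
  rw [key]
  simp only [add_zero, ← sub_eq_add_neg]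

end Current

end Summit.QuantumFields.BalabanUV.Beta.GAN24.WilsonLegCurrent

end
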